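import Literature.MathematicalPhysics.QuantumFieldTheory.Balaban1983to89.B15Prop1RightInverseFromLinearisedAveraging

/-!
# `Balaban1983to89.B15Prop1LinearisedKernelDictionary` — [Balaban1985Variational] = «[15]», (3)–(4) p. 278, Sect. C (44)–(48) p. 285, (82)–(83) p. 290 («`Q_k(U₀)X = 0`»);
# [Balaban1988Convergent] (2.10)–(2.11) p. 256; [Balaban1985Averaging] (21) p. 21:
# THE KERNEL OF THE LINEARISED CONSTRAINT OF THE w1 LINEAGE IS THE KERNEL OF NODE 00's LINEARISED AVERAGING — `DΦ₀(0)⟨cplxVec p⟩ = 0 ↔ ∀ i, Q_{j_i}(U₀)(p̂·U₀)(c_i) = 0`,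
# with the tangent space of `SU(2)` in the left trivialisation (`W⋆·Ẇ ∈ 𝔰𝔲(2)`) as the bridge

Honest framing: statement-level skeleton of published theorems with citation tags; proofs where landed; nothing here is a claim about the
Yang–Mills mass gap.  Cell `pub-ymgap`, HUMAN RULING D-0149 (width seats), seat `pub-ymgap-dag-n12-w1` (g2; N12 = [B15]; U1a⁺ of the w1 lineage);
count-neutral; N12 NOT discharged; finite 𝕋⁴ at fixed ε; nothing continuum ∕ OS ∕ mass-gap ∕ Clay.

WHY.  The (β) letters of `B15Prop1MinimiserFamilyFromRightInverse` ∕ `B15Prop1SliceNondegeneracyFromRealCoercive` (this seat) ask positivity of the real second variation on the REAL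
KERNEL of the linearised constraint, written as `fderiv ℂ Φ₀ 0 ⟨cplxVec p, _⟩ = 0` (the lineage's complex log-datum coordinates `Φ₀`).  The sibling lanes phrase kernel directions
through NODE 00's linearised multi-scale averaging `dIterL` = print's `Q_k(U₀)` ([15] (82)–(83) «`Q_k(U₀)X = 0`»; `Node00.qLin_eq_zero_iff_hasDerivAt_zero`).  THIS MODULE proves the
two kernel conditions EQUIVALENT at a guarded base configuration `U₀` on the fibre of `W`:
`DΦ₀(0)⟨cplxVec p, _⟩ = 0 ↔ ∀ i, dIterL j_i ↑U₀ (b ↦ (Σ_a p_{b,a}E_a)·↑U₀ b) (c_i) = 0`.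
Ingredients: the velocity theorem `B15Prop1RightInverseFromLinearisedAveraging.hasDerivAt_coe_avgFamily_expMul_smul`, the linearised coordinates
`B15Prop1LinearisedDatumCoordinates.fderiv_datumCoord_expMulC_apply_of_hasDerivAt` (`DΦ₀(0)(cplxVec p)_i = T(W_i⋆·v_i)`), `B15Prop1OntoFromRightInverse.logCoordCLM_genE_sum`
(`T(Σ y_a E_a) = y`), and (§1) THE TANGENT SPACE OF `SU(2)`: for an `SU(2)`-valued differentiable curve `γ`, `γ(0)⋆·γ̇(0) ∈ 𝔰𝔲(2)` (skew from `γ⋆γ = 1`, traceless from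
`det γ = 1` by the `2 × 2` Jacobi formula), (§2) `𝔰𝔲(2) = {Σ_a y_a E_a}`.

CONTENTS (theorems only; no `def`, no `instance`, no `sorry`).  §1 `hasDerivAt_entry`, `hasDerivAt_det_fin_two`, ★ `star_mul_mem_lieSU_of_hasDerivAt`.  §2 ★ `exists_coord_of_mem_lieSU_two`.
§3 `fderiv_sliceDatum_eq_fderiv_datumCoord` (chain rule through the slice), ★★ `fderiv_sliceDatum_cplxVec_eq_zero_iff`.  §4 ★★★ `hMin_atRecord_of_node00Letters`
(the lineage's best theorem with (45) AND the kernel of (β) in NODE 00's `dIterL` currency).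
HONEST SCOPE: matrix calculus and bookkeeping; nothing of Bałaban's asserted; count-neutral; N12 NOT discharged; the YM mass gap (Clay) is NOT proved by any of this — R4 closes only
the conditional finite-𝕋⁴ rung `BalabanLadder.UV`.
-/

noncomputable section

namespace Literature.MathematicalPhysics.QuantumFieldTheory.Balaban1983to89.B15Prop1LinearisedKernelDictionary

open Set Metric Filter
open scoped Topology ComplexConjugate
open Literature.MathematicalPhysics.QuantumFieldTheory.Balaban1983to89.Node00 (SU coeField coeField_apply SmallBelow ConstrSet constrCard constrEnum dIterL star_coe_mul_coe_SU)
open T4AdjointCovarianceUnitary (lieSU mem_lieSU_iff)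
open B15AveragingHolomorphic (iterMh)
open B15SU2ChartHolomorphic (genE expMulC logCoordC genE_zero_eq genE_one_eq genE_two_eq)
open B15Prop1StateChartSU2 (analyticAt_expMulC_right)
open B15Prop1DatumCoordinates (eventually_analyticAt_datumCoord expMulC_zero_left)
open B15Prop1LinearisedDatumCoordinates (exists_logCoordCLM fderiv_datumCoord_expMulC_apply_of_hasDerivAt)
open B15Prop1OntoFromRightInverse (logCoordCLM_genE_sum)
open B15Prop1RightInverseFromLinearisedAveraging (hasDerivAt_coe_avgFamily_expMul_smul hMin_atRecord_of_linearisedAveragingLetters)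
open B15Prop1SliceNondegeneracyFromRealCoercive (hnondeg_slice_of_realSecondVariation_pos)
open B15ComplexifiedDatumFamily (conjVec)
open Literature.MathematicalPhysics.QuantumFieldTheory.BalabanImbrieJaffe1984to88.BIJ85Eq453GaugeField (qsstarGIter0)
open B15ShellGauge193 (shellGauge)
open B15Extension193 (extend)
open B15Prop1AnalyticExtClause (cplxVec)
open B15Prop1ChartCalculusSU2 (E3)
open B15Prop1ChartSU2 (su2Chart)
open B16Sect1Backgrounds (expMul expMul_zero)
open ExpMeanLog (expMeanLogSU)
open BlockAveraging (blockAvg)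
open T4CubeChartGnomonic (SU2)
open T4Continuum B15DeterminingSets GaugeField
open scoped Matrix.Norms.L2Operator

/-! ## §1  The tangent space of `SU(2)` in the left trivialisation -/

section Tangent

/-- Entries of a differentiable matrix curve are differentiable with the entries of the velocity. [cite: Balaban1985Averaging, (21) p.21 (bookkeeping)] -/
theorem hasDerivAt_entry {γ : ℝ → Matrix (Fin 2) (Fin 2) ℂ} {v : Matrix (Fin 2) (Fin 2) ℂ} (hγ : HasDerivAt γ v 0) (i j : Fin 2) :
    HasDerivAt (fun s => γ s i j) (v i j) 0 :=
  (LinearMap.toContinuousLinearMap ((Matrix.entryLinearMap ℂ ℂ i j).restrictScalars ℝ)).hasFDerivAt.comp_hasDerivAt 0 hγ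

/-- The `2 × 2` Jacobi formula along a curve: `d∕ds det γ = γ̇₀₀γ₁₁ + γ₀₀γ̇₁₁ − (γ̇₀₁γ₁₀ + γ₀₁γ̇₁₀)`. [cite: Balaban1985Averaging, (21) p.21 (bookkeeping)] -/
theorem hasDerivAt_det_fin_two {γ : ℝ → Matrix (Fin 2) (Fin 2) ℂ} {v : Matrix (Fin 2) (Fin 2) ℂ} (hγ : HasDerivAt γ v 0) :
    HasDerivAt (fun s => (γ s).det) (v 0 0 * γ 0 1 1 + γ 0 0 0 * v 1 1 - (v 0 1 * γ 0 1 0 + γ 0 0 1 * v 1 0)) 0 := by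
  have h : (fun s => (γ s).det) = fun s => γ s 0 0 * γ s 1 1 - γ s 0 1 * γ s 1 0 := funext fun s => Matrix.det_fin_two _
  rw [h]
  exact ((hasDerivAt_entry hγ 0 0).mul (hasDerivAt_entry hγ 1 1)).sub ((hasDerivAt_entry hγ 0 1).mul (hasDerivAt_entry hγ 1 0))

/-- ★ **THE TANGENT SPACE OF `SU(2)`, LEFT-TRIVIALISED**: for a differentiable curve `γ` of unitary `2 × 2` matrices of determinant `1` with velocity `v` at `0`,
`γ(0)⋆ · v ∈ 𝔰𝔲(2)` — skew-Hermitian by differentiating `γ⋆γ = 1`, traceless by differentiating `det γ = 1` (`γ⋆ = adj γ`). [cite: Balaban1985Variational, (3)–(4) p.278 («`U·exp X`, `X ∈ 𝔤`»); Balaban1985Averaging, (21) p.21] -/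
theorem star_mul_mem_lieSU_of_hasDerivAt {γ : ℝ → Matrix (Fin 2) (Fin 2) ℂ} {v : Matrix (Fin 2) (Fin 2) ℂ} (hγ : HasDerivAt γ v 0)
    (hU : ∀ s, γ s ∈ Matrix.unitaryGroup (Fin 2) ℂ) (hdet : ∀ s, (γ s).det = 1) :
    star (γ 0) * v ∈ lieSU (Fin 2) := by
  rw [mem_lieSU_iff]
  constructor
  · have h1 : HasDerivAt (fun s => star (γ s) * γ s) (star v * γ 0 + star (γ 0) * v) 0 := (hγ.star).mul hγ
    have h2 : (fun s => star (γ s) * γ s) = fun _ => (1 : Matrix (Fin 2) (Fin 2) ℂ) :=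
      funext fun s => Matrix.mem_unitaryGroup_iff'.mp (hU s)
    rw [h2] at h1
    have h0 : star v * γ 0 + star (γ 0) * v = 0 := h1.unique (hasDerivAt_const (0 : ℝ) (1 : Matrix (Fin 2) (Fin 2) ℂ))
    rw [star_mul, star_star]
    exact eq_neg_of_add_eq_zero_left h0
  · have hd := hasDerivAt_det_fin_two hγ
    have h2 : (fun s => (γ s).det) = fun _ => (1 : ℂ) := funext hdet
    rw [h2] at hd
    have h0 := hd.unique (hasDerivAt_const (0 : ℝ) (1 : ℂ))
    have hstar : star (γ 0) = (γ 0).adjugate := by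
      have hinv : (γ 0)⁻¹ = star (γ 0) := Matrix.inv_eq_left_inv (Matrix.mem_unitaryGroup_iff'.mp (hU 0))
      rw [← hinv, Matrix.inv_def, hdet 0, Ring.inverse_one, one_smul]
    rw [hstar, Matrix.adjugate_fin_two, Matrix.trace_fin_two]
    simp only [Matrix.mul_apply, Fin.sum_univ_two, Matrix.of_apply, Matrix.cons_val', Matrix.cons_val_zero, Matrix.cons_val_one,
      Matrix.empty_val', Matrix.cons_val_fin_one]
    linear_combination h0

end Tangent

/-! ## §2  `𝔰𝔲(2)` is spanned by the generators `E_a` -/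

section Span

/-- ★ **EVERY ELEMENT OF `𝔰𝔲(2)` IS `Σ_a y_a E_a` WITH REAL `y`** (`y = (Im M₀₀, Re M₀₁, Im M₀₁)`). [cite: Balaban1989LargeFieldII, (1.19) p.360 («iΣ B^a σ_a»); Balaban1985Averaging, (17) p.21] -/
theorem exists_coord_of_mem_lieSU_two {M : Matrix (Fin 2) (Fin 2) ℂ} (hM : M ∈ lieSU (Fin 2)) :
    ∃ y : EuclideanSpace ℝ (Fin 3), M = ∑ a : Fin 3, ((y a : ℝ) : ℂ) • genE a := by
  rw [mem_lieSU_iff] at hM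
  obtain ⟨hskew, htr⟩ := hM
  have h00 : conj (M 0 0) = -M 0 0 := by
    have := congrArg (fun N : Matrix (Fin 2) (Fin 2) ℂ => N 0 0) hskew
    simpa [Matrix.star_apply] using this
  have h10 : conj (M 0 1) = -M 1 0 := by
    have := congrArg (fun N : Matrix (Fin 2) (Fin 2) ℂ => N 1 0) hskew
    simpa [Matrix.star_apply] using this
  have h11 : M 1 1 = -M 0 0 := by
    rw [Matrix.trace_fin_two] at htr
    linear_combination htr
  have hre00 : (M 0 0).re = 0 := by
    have := congrArg Complex.re h00
    simp at this; linarith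
  have hre10 : (M 1 0).re = -(M 0 1).re := by
    have := congrArg Complex.re h10
    simp at this; linarith
  have him10 : (M 1 0).im = (M 0 1).im := by
    have := congrArg Complex.im h10
    simp at this; linarith
  refine ⟨WithLp.toLp 2 ![(M 0 0).im, (M 0 1).re, (M 0 1).im], ?_⟩
  rw [Fin.sum_univ_three, genE_zero_eq, genE_one_eq, genE_two_eq]
  ext i j
  fin_cases i <;> fin_cases j
  · apply Complex.ext <;> simp [hre00]
  · apply Complex.ext <;> simp
  · apply Complex.ext <;> simp [hre10, him10]
  · apply Complex.ext
    · simp [h11, hre00]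
    · simp [h11]

end Span

/-! ## §3  The kernel dictionary on the slice -/

section Kernel

variable {P : Params}

/-- **CHAIN RULE THROUGH THE SLICE**: for the slice datum coordinates `Φ₀ = (X ↦ κ (expMulC X ↑U₀)) ∘ ι_S` with the full-space map differentiable at `0`,
`DΦ₀(0)⟨X, _⟩ = D(κ ∘ χ)(0) X`. [cite: Balaban1985Variational, Sect. G p.305 (bookkeeping)] -/
theorem fderiv_sliceDatum_eq_fderiv_datumCoord {F : Type*} [NormedAddCommGroup F] [NormedSpace ℂ F]
    (S : Submodule ℂ (VecField P 0 (EuclideanSpace ℂ (Fin 3)))) {g : VecField P 0 (EuclideanSpace ℂ (Fin 3)) → F} {Φ₀ : S → F}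
    (hΦ₀ : ∀ X : S, Φ₀ X = g (X : VecField P 0 (EuclideanSpace ℂ (Fin 3)))) (hg : DifferentiableAt ℂ g 0)
    {X : VecField P 0 (EuclideanSpace ℂ (Fin 3))} (hX : X ∈ S) :
    fderiv ℂ Φ₀ 0 ⟨X, hX⟩ = fderiv ℂ g 0 X := by
  have hfun : Φ₀ = g ∘ S.subtypeL := funext fun Y => hΦ₀ Y
  have hg' : DifferentiableAt ℂ g (S.subtypeL 0) := by
    rw [map_zero]; exact hg
  rw [hfun, fderiv_comp 0 hg' S.subtypeL.differentiableAt, S.subtypeL.fderiv, map_zero]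
  rfl

/-- ★★ **THE KERNEL DICTIONARY.**  At a configuration `U₀` on the fibre of `W` (`AgreeOn`), guarded below `k`, for the slice datum coordinates `Φ₀` of the lineage (pointwise, as in
`B15Prop1LocalChartAtBaseField.exists_localChart_at_baseField`) and a real slice field `p`:
`DΦ₀(0)⟨cplxVec p, _⟩ = 0 ↔ ∀ i, dIterL j_i ↑U₀ (b ↦ (Σ_a p_{b,a} E_a)·↑U₀ b) (c_i) = 0` — the real kernel of the linearised constraint IS the kernel of NODE 00's linearised
multi-scale averaging `Q(U₀)` on the left-invariant field of `p` ([15] (82)–(83)).  `⇐`: `DΦ₀(0)(cplxVec p)_i = T(W_i⋆·v_i)` with `v_i` that value; `⇒`: `W_i⋆·v_i ∈ 𝔰𝔲(2)` (tangent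
space, §1, the curve `s ↦ Ū^{j_i}(exp(s p̂)·U₀)(c_i)` through `W_i`), `= Σ y_a E_a` (§2), and `T(Σ y_a E_a) = y`.
[cite: Balaban1985Variational, (3)–(4) p.278, Sect. C (44)–(48) p.285, (82)–(83) p.290; Balaban1988Convergent, (2.10)–(2.11) p.256; Balaban1985Averaging, (21) p.21] -/
theorem fderiv_sliceDatum_cplxVec_eq_zero_iff (𝔹 : DetSet P) (k : ℕ) (W : MSField P SU2) {U₀ : GaugeField P 0 SU2}
    (hsbU : SmallBelow (fun j => blockAvg (P := P) (j := j) expMeanLogSU) k U₀)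
    (hU₀ : AgreeOn 𝔹 (avgFamily (fun j => blockAvg (P := P) (j := j) expMeanLogSU) U₀) W)
    (S : Submodule ℂ (VecField P 0 (EuclideanSpace ℂ (Fin 3))))
    {Φ₀ : S → Fin (constrCard 𝔹 k) → EuclideanSpace ℂ (Fin 3)}
    (hΦ₀ : ∀ (X : S) i, Φ₀ X i = logCoordC (star ((W ((constrEnum 𝔹 k).symm i).1 ((constrEnum 𝔹 k).symm i).2.1 : SU2) : Matrix (Fin 2) (Fin 2) ℂ) *
      iterMh ((constrEnum 𝔹 k).symm i).1 (expMulC (X : VecField P 0 (EuclideanSpace ℂ (Fin 3))) (coeField U₀)) ((constrEnum 𝔹 k).symm i).2.1))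
    {p : VecField P 0 E3} (hp : cplxVec p ∈ S) :
    fderiv ℂ Φ₀ 0 ⟨cplxVec p, hp⟩ = 0 ↔
      ∀ i : Fin (constrCard 𝔹 k), dIterL ((constrEnum 𝔹 k).symm i).1 (coeField U₀)
        (fun b => (∑ a : Fin 3, ((p b a : ℝ) : ℂ) • genE a) * ((U₀ b : SU2) : Matrix (Fin 2) (Fin 2) ℂ)) ((constrEnum 𝔹 k).symm i).2.1 = 0 := by
  obtain ⟨T, hT⟩ := exists_logCoordCLM
  -- the datum coordinates on the full space, pointwise
  set κ : (PBond P 0 → Matrix (Fin 2) (Fin 2) ℂ) → Fin (constrCard 𝔹 k) → EuclideanSpace ℂ (Fin 3) := fun Q i =>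
    logCoordC (star ((W ((constrEnum 𝔹 k).symm i).1 ((constrEnum 𝔹 k).symm i).2.1 : SU2) : Matrix (Fin 2) (Fin 2) ℂ) *
      iterMh ((constrEnum 𝔹 k).symm i).1 Q ((constrEnum 𝔹 k).symm i).2.1) with hκdef
  have hκ : ∀ Q i, κ Q i = logCoordC (star ((W ((constrEnum 𝔹 k).symm i).1 ((constrEnum 𝔹 k).symm i).2.1 : SU2) : Matrix (Fin 2) (Fin 2) ℂ) *
      iterMh ((constrEnum 𝔹 k).symm i).1 Q ((constrEnum 𝔹 k).symm i).2.1) := fun Q i => rfl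
  have hΦ₀κ : ∀ X : S, Φ₀ X = (fun Y : VecField P 0 (EuclideanSpace ℂ (Fin 3)) => κ (expMulC Y (coeField U₀))) (X : VecField P 0 (EuclideanSpace ℂ (Fin 3))) :=
    fun X => funext fun i => by rw [hΦ₀]
  have hκan : AnalyticAt ℂ κ (coeField U₀) := (eventually_analyticAt_datumCoord 𝔹 k W κ hκ hsbU hU₀).self_of_nhds
  have hg : DifferentiableAt ℂ (fun Y : VecField P 0 (EuclideanSpace ℂ (Fin 3)) => κ (expMulC Y (coeField U₀))) 0 := by
    have h1 : AnalyticAt ℂ κ (expMulC (0 : VecField P 0 (EuclideanSpace ℂ (Fin 3))) (coeField U₀)) := by rw [expMulC_zero_left]; exact hκan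
    exact (AnalyticAt.comp (f := fun Y : VecField P 0 (EuclideanSpace ℂ (Fin 3)) => expMulC Y (coeField U₀)) (x := 0) h1
      (analyticAt_expMulC_right (coeField U₀) 0)).differentiableAt
  have hchain := fderiv_sliceDatum_eq_fderiv_datumCoord S hΦ₀κ hg hp
  -- velocities and the linearised coordinates
  have hv : ∀ i : Fin (constrCard 𝔹 k), HasDerivAt (fun s : ℝ => ((avgFamily (fun j => blockAvg (P := P) (j := j) expMeanLogSU) (expMul su2Chart (s • p) U₀)
      ((constrEnum 𝔹 k).symm i).1 ((constrEnum 𝔹 k).symm i).2.1 : SU2) : Matrix (Fin 2) (Fin 2) ℂ))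
      (dIterL ((constrEnum 𝔹 k).symm i).1 (coeField U₀) (fun b => (∑ a : Fin 3, ((p b a : ℝ) : ℂ) • genE a) * ((U₀ b : SU2) : Matrix (Fin 2) (Fin 2) ℂ))
        ((constrEnum 𝔹 k).symm i).2.1) 0 :=
    fun i => hasDerivAt_coe_avgFamily_expMul_smul (hsbU.mono (Nat.lt_succ_iff.1 ((constrEnum 𝔹 k).symm i).1.2)) p _
  have hF : ∀ i, fderiv ℂ (fun Y : VecField P 0 (EuclideanSpace ℂ (Fin 3)) => κ (expMulC Y (coeField U₀))) 0 (cplxVec p) i =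
      T (star ((W ((constrEnum 𝔹 k).symm i).1 ((constrEnum 𝔹 k).symm i).2.1 : SU2) : Matrix (Fin 2) (Fin 2) ℂ) *
        dIterL ((constrEnum 𝔹 k).symm i).1 (coeField U₀) (fun b => (∑ a : Fin 3, ((p b a : ℝ) : ℂ) • genE a) * ((U₀ b : SU2) : Matrix (Fin 2) (Fin 2) ℂ))
          ((constrEnum 𝔹 k).symm i).2.1) :=
    fun i => fderiv_datumCoord_expMulC_apply_of_hasDerivAt 𝔹 k W κ hκ hsbU hU₀ hT p i (hv i)
  rw [hchain]
  constructor
  · intro h0 i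
    set s₀ := (constrEnum 𝔹 k).symm i with hs₀
    set Wm : Matrix (Fin 2) (Fin 2) ℂ := ((W s₀.1 s₀.2.1 : SU2) : Matrix (Fin 2) (Fin 2) ℂ) with hWm
    set v := dIterL s₀.1 (coeField U₀) (fun b => (∑ a : Fin 3, ((p b a : ℝ) : ℂ) • genE a) * ((U₀ b : SU2) : Matrix (Fin 2) (Fin 2) ℂ)) s₀.2.1 with hvdef
    have hTi : T (star Wm * v) = 0 := by rw [← hF i, h0]; rfl
    -- the curve through `W_i` and its tangent
    have hγ0 : ((avgFamily (fun j => blockAvg (P := P) (j := j) expMeanLogSU) (expMul su2Chart ((0 : ℝ) • p) U₀) s₀.1 s₀.2.1 : SU2) : Matrix (Fin 2) (Fin 2) ℂ) = Wm := by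
      rw [zero_smul, expMul_zero, hU₀ _ _ s₀.2.2]
    have hunit : ∀ s : ℝ, ((avgFamily (fun j => blockAvg (P := P) (j := j) expMeanLogSU) (expMul su2Chart (s • p) U₀) s₀.1 s₀.2.1 : SU2) :
        Matrix (Fin 2) (Fin 2) ℂ) ∈ Matrix.unitaryGroup (Fin 2) ℂ := fun s =>
      Matrix.specialUnitaryGroup_le_unitaryGroup (avgFamily (fun j => blockAvg (P := P) (j := j) expMeanLogSU) (expMul su2Chart (s • p) U₀) s₀.1 s₀.2.1).2
    have hdet : ∀ s : ℝ, (((avgFamily (fun j => blockAvg (P := P) (j := j) expMeanLogSU) (expMul su2Chart (s • p) U₀) s₀.1 s₀.2.1 : SU2) :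
        Matrix (Fin 2) (Fin 2) ℂ)).det = 1 := fun s =>
      (Matrix.mem_specialUnitaryGroup_iff.mp (avgFamily (fun j => blockAvg (P := P) (j := j) expMeanLogSU) (expMul su2Chart (s • p) U₀) s₀.1 s₀.2.1).2).2
    have hmem0 := star_mul_mem_lieSU_of_hasDerivAt (hv i) hunit hdet
    have hmem : star Wm * v ∈ lieSU (Fin 2) := by
      rw [← hγ0]; exact hmem0
    obtain ⟨y, hy⟩ := exists_coord_of_mem_lieSU_two hmem
    set y' : EuclideanSpace ℂ (Fin 3) := WithLp.toLp 2 fun a => ((y a : ℝ) : ℂ) with hy'def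
    have hy'ap : ∀ a, y' a = ((y a : ℝ) : ℂ) := fun a => rfl
    have hTy : T (star Wm * v) = y' := by
      rw [hy]
      exact logCoordCLM_genE_sum hT y'
    have hy0 : y = 0 := by
      ext a
      have h1 : y' a = (0 : EuclideanSpace ℂ (Fin 3)) a := by rw [← hTy, hTi]
      rw [hy'ap] at h1
      have h2 : ((y a : ℝ) : ℂ) = 0 := by simpa using h1
      have h3 : y a = 0 := by exact_mod_cast h2
      simpa using h3
    have hWv : star Wm * v = 0 := by
      rw [hy, hy0]; simp
    calc v = Wm * (star Wm * v) := by
          rw [← mul_assoc, Unitary.mul_star_self_of_mem (Matrix.specialUnitaryGroup_le_unitaryGroup (W s₀.1 s₀.2.1).2), one_mul]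
      _ = 0 := by rw [hWv, mul_zero]
  · intro h0
    funext i
    rw [hF i, h0 i, mul_zero, map_zero]
    rfl

end Kernel

/-! ## §4  The lineage's best theorem with BOTH linearised letters in NODE 00's currency -/

section Record

variable {F : T4Family} {k : ℕ}

/-- ★★★ **THE LETTER (J0′) `hMin` AT NODE 00's OBJECTS FROM LETTERS IN NODE 00's CURRENCY** — per base field: a MINIMISER `U₀` of the base datum's (2.12) problem in the class of
record ([15] Thm 1 existence), the two (0.4) guards, a conjugation-stable slice `S` (any real gauge condition, `B15Prop1SliceComplexification`), the slice action `a` and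
log-datum coordinates `Φ₀` (pointwise); (45) a RIGHT INVERSE from the slice of the LINEAR map `p ↦ (Q_{j_i}(U₀)(p̂·U₀)(c_i))_i` (`dIterL`); (β) for every multiplier `ℓ₀` of the base
state, POSITIVITY of `d²∕dt²[wilsonAction4(exp(t p̂)·U₀) − Re ℓ₀(Φ₀(t p̂))]|₀` for every non-zero real slice field `p` KILLED BY THE LINEARISED AVERAGING (`∀ i, Q_{j_i}(U₀)(p̂·U₀)(c_i) = 0`);
the criticality transfer ([15] Sect. F); and [15] Thm 1's uniqueness clause.  Assembled from `hMin_atRecord_of_linearisedAveragingLetters`, `hnondeg_slice_of_realSecondVariation_pos`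
and the kernel dictionary `fderiv_sliceDatum_cplxVec_eq_zero_iff`. [cite: Balaban1985Variational, Thm 1 p.279, (3)–(4) p.278, Sect. C (44)–(48) p.285, (82)–(83) p.290, Sect. F p.300, Sect. G pp.305–307, Prop. 9 (190) p.309; Balaban1989LargeFieldI, (1.74) p.192, Prop. 1 p.194; Balaban1989LargeFieldII, (1.9) p.358, (1.12) p.359; Balaban1988Convergent, (2.10)–(2.12) p.256] -/
theorem hMin_atRecord_of_node00Letters (ν : Node00.Stage7Numerics) (Kt kc : ℕ) (Ω : ℕ → Set (Site (F.P Kt) 0))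
    (Λ : Set (Site (F.P Kt) k)) (lo hi : Fin (F.P Kt).d → ℤ) (𝔹 : DetSet (F.P Kt)) (h𝔹 : ∀ j, k < j → 𝔹 j = ∅)
    (ext : GaugeField (F.P Kt) k SU2 → GaugeField (F.P Kt) k SU2) (hext : ∀ W, ext W = extend Λ (shellGauge W lo hi) W)
    {K : Set (GaugeField (F.P Kt) k SU2)} (hK : IsCompact K) {𝓐₀ : ℝ} (h𝓐₀ : 1 < 𝓐₀)
    (Crit : GaugeField (F.P Kt) 0 SU2 → GaugeField (F.P Kt) 0 SU2 → Prop)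
    (hbase : ∀ Vk ∈ K, ∃ (U₀ : GaugeField (F.P Kt) 0 SU2) (S : Submodule ℂ (VecField (F.P Kt) 0 (EuclideanSpace ℂ (Fin 3))))
        (a : S → ℂ) (Φ₀ : S → Fin (constrCard 𝔹 k) → EuclideanSpace ℂ (Fin 3)),
      IsMinimizer (Node00.avOfRecord F 2 Kt) (Node00.regMSCoPOfRecord F 2 ν Kt kc Ω) 𝔹
        (avgFamily (Node00.avOfRecord F 2 Kt) (qsstarGIter0 k (ext Vk))) U₀ ∧
      SmallBelow (Node00.avOfRecord F 2 Kt) k (qsstarGIter0 k (ext Vk)) ∧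
      SmallBelow (Node00.avOfRecord F 2 Kt) k U₀ ∧
      (∀ X ∈ S, conjVec X ∈ S) ∧
      (∀ X : S, a X = ∑ p : Plaq (F.P Kt) 0, (1 - (expMulC (X : VecField (F.P Kt) 0 (EuclideanSpace ℂ (Fin 3))) (coeField U₀) ⟨p.src, p.μ⟩ *
        expMulC (X : VecField (F.P Kt) 0 (EuclideanSpace ℂ (Fin 3))) (coeField U₀) ⟨p.src.shift p.μ, p.ν⟩ *
        Matrix.adjugate (expMulC (X : VecField (F.P Kt) 0 (EuclideanSpace ℂ (Fin 3))) (coeField U₀) ⟨p.src.shift p.ν, p.μ⟩) *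
        Matrix.adjugate (expMulC (X : VecField (F.P Kt) 0 (EuclideanSpace ℂ (Fin 3))) (coeField U₀) ⟨p.src, p.ν⟩)).trace / 2)) ∧
      (∀ (X : S) i, Φ₀ X i = logCoordC (star ((avgFamily (Node00.avOfRecord F 2 Kt) (qsstarGIter0 k (ext Vk))
        ((constrEnum 𝔹 k).symm i).1 ((constrEnum 𝔹 k).symm i).2.1 : SU2) : Matrix (Fin 2) (Fin 2) ℂ) *
        iterMh ((constrEnum 𝔹 k).symm i).1 (expMulC (X : VecField (F.P Kt) 0 (EuclideanSpace ℂ (Fin 3))) (coeField U₀)) ((constrEnum 𝔹 k).symm i).2.1)) ∧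
      -- DISPLAYED ([15] (45), LINEAR currency): a right inverse of the linearised multi-scale averaging `Q(U₀)` from the slice
      (∀ τ : Fin (constrCard 𝔹 k) → EuclideanSpace ℝ (Fin 3), ∃ p : VecField (F.P Kt) 0 E3, cplxVec p ∈ S ∧
        ∀ i : Fin (constrCard 𝔹 k), dIterL ((constrEnum 𝔹 k).symm i).1 (coeField U₀)
          (fun b => (∑ a : Fin 3, ((p b a : ℝ) : ℂ) • genE a) * ((U₀ b : SU2) : Matrix (Fin 2) (Fin 2) ℂ)) ((constrEnum 𝔹 k).symm i).2.1 =
          ((avgFamily (Node00.avOfRecord F 2 Kt) (qsstarGIter0 k (ext Vk)) ((constrEnum 𝔹 k).symm i).1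
            ((constrEnum 𝔹 k).symm i).2.1 : SU2) : Matrix (Fin 2) (Fin 2) ℂ) * ∑ b : Fin 3, ((τ i b : ℝ) : ℂ) • genE b) ∧
      -- DISPLAYED ((β), REAL currency, kernel in `Q(U₀)` currency): positivity of the real second variation of the Lagrangian on the real kernel of the linearised averaging
      (∀ ℓ₀ : (Fin (constrCard 𝔹 k) → EuclideanSpace ℂ (Fin 3)) →L[ℂ] ℂ, fderiv ℂ a 0 = ℓ₀.comp (fderiv ℂ Φ₀ 0) →
        ∀ (p : VecField (F.P Kt) 0 E3) (hp : cplxVec p ∈ S), p ≠ 0 →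
          (∀ i : Fin (constrCard 𝔹 k), dIterL ((constrEnum 𝔹 k).symm i).1 (coeField U₀)
            (fun b => (∑ a : Fin 3, ((p b a : ℝ) : ℂ) • genE a) * ((U₀ b : SU2) : Matrix (Fin 2) (Fin 2) ℂ)) ((constrEnum 𝔹 k).symm i).2.1 = 0) →
          0 < deriv (deriv (fun t : ℝ => wilsonAction4 (expMul su2Chart (t • p) U₀) - (ℓ₀ (Φ₀ ((t : ℂ) • ⟨cplxVec p, hp⟩))).re)) 0) ∧
      -- DISPLAYED ([15] Sect. F): criticality transfer
      (∀ᶠ w in 𝓝 ((0 : S), coeField (qsstarGIter0 k (ext Vk))), ∀ (U' Q' : GaugeField (F.P Kt) 0 SU2) (μ : (Fin (constrCard 𝔹 k) → EuclideanSpace ℂ (Fin 3)) →L[ℂ] ℂ),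
        expMulC (w.1 : VecField (F.P Kt) 0 (EuclideanSpace ℂ (Fin 3))) (coeField U₀) = coeField U' → coeField Q' = w.2 →
          AgreeOn 𝔹 (avgFamily (Node00.avOfRecord F 2 Kt) U') (avgFamily (Node00.avOfRecord F 2 Kt) Q') →
          fderiv ℂ a w.1 = μ.comp (fderiv ℂ Φ₀ w.1) → Crit Q' U'))
    (hT1u : ∀ Vk ∈ K, ∀ᶠ Q in 𝓝 (coeField (qsstarGIter0 k (ext Vk))), ∀ U' Q' : GaugeField (F.P Kt) 0 SU2, coeField Q' = Q →
      U' ∈ Node00.regMSCoPOfRecord F 2 ν Kt kc Ω → AgreeOn 𝔹 (avgFamily (Node00.avOfRecord F 2 Kt) U') (avgFamily (Node00.avOfRecord F 2 Kt) Q') →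
        Crit Q' U' → IsMinimizer (Node00.avOfRecord F 2 Kt) (Node00.regMSCoPOfRecord F 2 ν Kt kc Ω) 𝔹 (avgFamily (Node00.avOfRecord F 2 Kt) Q') U') :
    ∃ R : ℝ, 0 < R ∧ ∀ Vk ∈ K,
      ∃ Ũ : VecField (F.P Kt) k (EuclideanSpace ℂ (Fin 3)) × VecField (F.P Kt) k (EuclideanSpace ℂ (Fin 3)) → PBond (F.P Kt) 0 → Matrix (Fin 2) (Fin 2) ℂ,
        (∀ b i j, DifferentiableOn ℂ (fun z => Ũ z b i j) (ball 0 R)) ∧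
        (∀ z ∈ ball (0 : VecField (F.P Kt) k (EuclideanSpace ℂ (Fin 3)) × VecField (F.P Kt) k (EuclideanSpace ℂ (Fin 3))) R, ∀ b i j, ‖Ũ z b i j‖ ≤ 𝓐₀) ∧
        ∀ p B' : VecField (F.P Kt) k E3, ‖p‖ < R → ‖B'‖ < R → ∃ U' : GaugeField (F.P Kt) 0 SU2,
          (∀ b, Ũ (cplxVec p, cplxVec B') b = ((U' b : SU2) : Matrix (Fin 2) (Fin 2) ℂ)) ∧
            IsMinimizer (Node00.avOfRecord F 2 Kt) (Node00.regMSCoPOfRecord F 2 ν Kt kc Ω) 𝔹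
              (avgFamily (Node00.avOfRecord F 2 Kt) (qsstarGIter0 k (expMul su2Chart B' (ext (expMul su2Chart p Vk))))) U' :=
  hMin_atRecord_of_linearisedAveragingLetters ν Kt kc Ω Λ lo hi 𝔹 h𝔹 ext hext hK h𝓐₀ Crit
    (fun Vk hVk => by
      obtain ⟨U₀, S, a, Φ₀, hmin, hsbQ, hsbU, hS, ha, hΦ₀, hR, hposN, hcritT⟩ := hbase Vk hVk
      refine ⟨U₀, S, a, Φ₀, hmin, hsbQ, hsbU, hS, ha, hΦ₀, hR, fun ℓ₀ hℓ₀ => ?_, hcritT⟩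
      exact hnondeg_slice_of_realSecondVariation_pos 𝔹 k _ hsbU hmin.2.1 S hS a ha Φ₀ hΦ₀ ℓ₀ fun p hp hne hker =>
        hposN ℓ₀ hℓ₀ p hp hne ((fderiv_sliceDatum_cplxVec_eq_zero_iff 𝔹 k _ hsbU hmin.2.1 S hΦ₀ hp).1 hker))
    hT1u

end Record

end Literature.MathematicalPhysics.QuantumFieldTheory.Balaban1983to89.B15Prop1LinearisedKernelDictionary

end
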